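import Mathlib
import Literature.MathematicalPhysics.QuantumLattice.BallSpecification
import Literature.Analysis.FunctionSpaces.SchwartzFunctionalSubsequenceLimit
import HarnessLib

/-!
# Measurable "kill-inside" extension selectors on `𝓢'(E)` via a parametrised Hahn–Banach theorem

Topic `MathematicalPhysics/QuantumLattice` (random fields / ball specifications, files `RandomField`,
`BallSpecification`): THEOREM-ONLY support file (requested by the route
`CriticalPhenomena/Ising3DConformalLimit/BallSpecification`, crux `BallSpecifiedFieldLimit`, for the
kernel-version lemma turning an a.e. germ-Markov property into everywhere-proper ball kernels).

* `exists_clm_le_sublinear_measurable` (**measurably parametrised Hahn–Banach theorem**): let `V` be a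
  real topological vector space with a dense sequence `x` and a countable neighbourhood basis, and
  `N θ : V → ℝ`, `θ ∈ Θ` (a measurable space), continuous sublinear functionals, measurable in `θ`
  at each fixed vector. Then there are continuous linear functionals `L θ ≤ N θ` with `θ ↦ L θ v`
  measurable for every `v`. This is the classical "one dimension at a time" proof of Hahn–Banach in
  a separable space (Rudin, *Functional Analysis*, Thm. 3.2/3.3), run greedily along the dense
  sequence: the value at `x n` is the upper end-point
  `c n = inf_{a ∈ ℚⁿ} (N (∑ aᵢ xᵢ + x n) - ∑ aᵢ cᵢ)` of the admissible interval, a countable infimum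
  of measurable functions of `θ`; then `L v = inf_{n, a ∈ ℚⁿ} (∑ aᵢ cᵢ + N (v - ∑ aᵢ xᵢ))`.
* `exists_killInside_selector`: for disjoint `U, B ⊆ E` (`E` finite-dimensional; in the
  application `U = (closedBall c r)ᶜ`, `B = ball c r`) there is `P : FieldConfig E → FieldConfig E`
  such that `P ξ` AGREES WITH `ξ` on the test functions supported in `U`, VANISHES on those
  supported in `B`, and `ξ ↦ P ξ v` is measurable for the σ-algebra `extEvents U` of the events
  seen in `U`. Construction: a Hahn–Banach extension of `z + z' ↦ ξ z` (`tsupport z ⊆ U`,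
  `tsupport z' ⊆ B`), dominated by `K(ξ) · P_{K(ξ)}` (`P_m` the sum of the Schwartz seminorms of
  bi-order `≤ (m, m)`, `K(ξ)` the least admissible integer, read off the values of `ξ` at a dense
  sequence of `U`-supported test functions — this is where the disjointness of supports enters:
  `p(z) ≤ p(z + z')`), chosen measurably by the first theorem applied to the sublinear functionals
  `N_ξ v = inf_{i,j} (ξ zᵢ + K(ξ) P_{K(ξ)} (v - zᵢ - z'ⱼ))`.

References: W. Rudin, *Functional Analysis*, 2nd ed. (1991), Thm. 3.2 (one-step extension) and
Thm. 3.3; the measurable-selection phrasing is folklore. Mathlib: `exists_extension_of_le_sublinear`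
(used for the existence half), `SchwartzMap`, `Seminorm.bound_of_continuous`.
-/

noncomputable section

namespace Literature.MathematicalPhysics.QuantumLattice

open _root_.MeasureTheory Set Filter _root_.Topology

section MeasurableHahnBanach

variable {Θ V : Type*} {mΘ : MeasurableSpace Θ} [AddCommGroup V] [Module ℝ V]

/-- A finitely supported combination is a combination over `Fin n` for some `n`. [folklore] -/
theorem exists_fin_of_finsupp (l : ℕ →₀ ℝ) (c : ℕ → ℝ) (x : ℕ → V) :
    ∃ (n : ℕ) (b : Fin n → ℝ), (l.sum fun i r => r * c i) = ∑ i, b i * c i ∧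
      (l.sum fun i r => r • x i) = ∑ i, b i • x i := by
  refine ⟨l.support.sup id + 1, fun i => l i, ?_, ?_⟩
  · have hs : l.support ⊆ Finset.range (l.support.sup id + 1) := by
      intro i hi
      have : i ≤ l.support.sup id := Finset.le_sup (f := id) hi
      exact Finset.mem_range.2 (Nat.lt_succ_of_le this)
    rw [Finsupp.sum_of_support_subset l hs _ (fun i _ => by simp)]
    exact (Fin.sum_univ_eq_sum_range (fun i => l i * c i) _).symm
  · have hs : l.support ⊆ Finset.range (l.support.sup id + 1) := by
      intro i hi
      have : i ≤ l.support.sup id := Finset.le_sup (f := id) hi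
      exact Finset.mem_range.2 (Nat.lt_succ_of_le this)
    rw [Finsupp.sum_of_support_subset l hs _ (fun i _ => by simp)]
    exact (Fin.sum_univ_eq_sum_range (fun i => l i • x i) _).symm

/-- The rational tuple `(0, …, 0, 1)` of length `m + 1` picks out `x m`. [folklore] -/
theorem sum_ite_last_smul (m : ℕ) (x : ℕ → V) :
    (∑ i : Fin (m + 1), (((if (i : ℕ) = m then 1 else 0 : ℚ) : ℚ) : ℝ) • x i) = x m := by
  rw [Fin.sum_univ_castSucc, Finset.sum_eq_zero (fun i _ => by simp [Nat.ne_of_lt i.2])]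
  simp

/-- The rational tuple `(0, …, 0, 1)` of length `m + 1` picks out `c m`. [folklore] -/
theorem sum_ite_last_mul (m : ℕ) (c : ℕ → ℝ) :
    (∑ i : Fin (m + 1), (((if (i : ℕ) = m then 1 else 0 : ℚ) : ℚ) : ℝ) * c i) = c m := by
  rw [Fin.sum_univ_castSucc, Finset.sum_eq_zero (fun i _ => by simp [Nat.ne_of_lt i.2])]
  simp

/-- Rational tuples are dense among real tuples: every `d : Fin n → ℝ` is the limit of a sequence of
casts of rational tuples. [folklore] -/
theorem exists_seq_ratCast_tendsto {n : ℕ} (d : Fin n → ℝ) :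
    ∃ a : ℕ → (Fin n → ℚ), Tendsto (fun k => fun i => ((a k i : ℚ) : ℝ)) atTop (𝓝 d) := by
  have h : ∀ i : Fin n, ∃ q : ℕ → ℚ, Tendsto (fun k => ((q k : ℚ) : ℝ)) atTop (𝓝 (d i)) := by
    intro i
    have hmem : d i ∈ closure (Set.range ((↑) : ℚ → ℝ)) := by
      rw [Rat.denseRange_cast.closure_range]; exact Set.mem_univ _
    obtain ⟨y, hy, hlim⟩ := mem_closure_iff_seq_limit.1 hmem
    choose q hq using fun k => Set.mem_range.1 (hy k)
    refine ⟨q, ?_⟩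
    have : (fun k => ((q k : ℚ) : ℝ)) = y := funext hq
    rwa [this]
  choose q hq using h
  refine ⟨fun k i => q i k, ?_⟩
  rw [tendsto_pi_nhds]
  exact fun i => hq i

variable [TopologicalSpace V] [IsTopologicalAddGroup V]

/-- A linear functional dominated by a continuous sublinear functional vanishing at `0` is continuous.
[folklore] -/
theorem continuous_of_le_of_continuous_sublinear (g : V →ₗ[ℝ] ℝ) (N : V → ℝ) (hN : Continuous N)
    (hN0 : N 0 = 0) (hg : ∀ v, g v ≤ N v) : Continuous g := by
  refine continuous_of_continuousAt_zero g.toAddMonoidHom ?_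
  change Tendsto g (𝓝 0) (𝓝 (g 0))
  rw [map_zero]
  have hup : Tendsto N (𝓝 (0 : V)) (𝓝 0) := by simpa [hN0] using hN.tendsto 0
  have hlow : Tendsto (fun v => -N (-v)) (𝓝 (0 : V)) (𝓝 0) := by
    have h1 : Tendsto (fun v : V => -v) (𝓝 0) (𝓝 0) := by
      simpa using (continuous_neg (G := V)).tendsto 0
    simpa using (hup.comp h1).neg
  refine tendsto_of_tendsto_of_tendsto_of_le_of_le hlow hup (fun v => ?_) (fun v => hg v)
  have := hg (-v)
  rw [map_neg] at this
  linarith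

variable [ContinuousSMul ℝ V] [FirstCountableTopology V]

/-- **Measurably parametrised Hahn–Banach theorem.** Let `x` be a dense sequence of the real
topological vector space `V` (first countable), and `N θ`, `θ ∈ Θ`, continuous sublinear functionals
on `V`, measurable in `θ` at each fixed vector. Then there are continuous linear functionals
`L θ ≤ N θ` with `θ ↦ L θ v` measurable for every `v`. (Greedy one-dimensional extensions along the
dense sequence with the upper end-point of the admissible interval, a countable infimum; then
`L θ v = inf (∑ aᵢ cᵢ(θ) + N θ (v - ∑ aᵢ xᵢ))` over rational tuples.) [folklore] -/
theorem exists_clm_le_sublinear_measurable (x : ℕ → V) (hx : DenseRange x) (N : Θ → V → ℝ)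
    (hadd : ∀ θ v w, N θ (v + w) ≤ N θ v + N θ w)
    (hhom : ∀ θ (c : ℝ), 0 < c → ∀ v, N θ (c • v) = c * N θ v)
    (hcont : ∀ θ, Continuous (N θ)) (hmeas : ∀ v, Measurable fun θ => N θ v) :
    ∃ L : Θ → V →L[ℝ] ℝ, (∀ θ v, L θ v ≤ N θ v) ∧ ∀ v, Measurable fun θ => L θ v := by
  classical
  -- elementary consequences of sublinearity
  have hN0 : ∀ θ, N θ 0 = 0 := by
    intro θ
    have h := hhom θ 2 two_pos 0
    rw [smul_zero] at h
    linarith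
  have hNneg : ∀ θ v, -N θ (-v) ≤ N θ v := by
    intro θ v
    have h := hadd θ v (-v)
    rw [add_neg_cancel, hN0] at h
    linarith
  -- the greedy coefficients
  let step : Θ → (n : ℕ) → (ℕ → ℝ) → ℝ := fun θ n t =>
    ⨅ a : Fin n → ℚ, (N θ ((∑ i : Fin n, ((a i : ℚ) : ℝ) • x i) + x n) -
      ∑ i : Fin n, ((a i : ℚ) : ℝ) * t i)
  let T : Θ → ℕ → (ℕ → ℝ) := fun θ n =>
    Nat.rec (motive := fun _ => ℕ → ℝ) (fun _ => 0) (fun k t => Function.update t k (step θ k t)) n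
  have hTsucc : ∀ θ k, T θ (k + 1) = Function.update (T θ k) k (step θ k (T θ k)) := fun θ k => rfl
  let c : Θ → ℕ → ℝ := fun θ n => T θ (n + 1) n
  have hTc : ∀ θ m i, i < m → T θ m i = c θ i := by
    intro θ m
    induction m with
    | zero => intro i hi; exact absurd hi (Nat.not_lt_zero i)
    | succ m ih =>
      intro i hi
      rcases Nat.lt_succ_iff_lt_or_eq.1 hi with hlt | rfl
      · rw [hTsucc, Function.update_of_ne (Nat.ne_of_lt hlt), ih i hlt]
      · rfl
  -- the defining formula of `c θ n`
  set φ : Θ → (n : ℕ) → (Fin n → ℝ) → ℝ := fun θ n d =>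
    N θ ((∑ i : Fin n, d i • x i) + x n) - ∑ i : Fin n, d i * c θ i with hφ
  have hc_eq : ∀ θ n, c θ n = ⨅ a : Fin n → ℚ, φ θ n (fun i => ((a i : ℚ) : ℝ)) := by
    intro θ n
    change Function.update (T θ n) n (step θ n (T θ n)) n = _
    rw [Function.update_self]
    change (⨅ a : Fin n → ℚ, (N θ ((∑ i : Fin n, ((a i : ℚ) : ℝ) • x i) + x n) -
      ∑ i : Fin n, ((a i : ℚ) : ℝ) * T θ n i)) = _
    congr 1
    funext a
    simp only [hφ]
    congr 1
    exact Finset.sum_congr rfl fun i _ => by rw [hTc θ n i i.2]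
  -- measurability of the coefficients
  have hc_meas : ∀ n, Measurable fun θ => c θ n := by
    intro n
    induction n using Nat.strong_induction_on with
    | _ n ih =>
      have heq : (fun θ => c θ n) = fun θ => ⨅ a : Fin n → ℚ, φ θ n (fun i => ((a i : ℚ) : ℝ)) :=
        funext fun θ => hc_eq θ n
      rw [heq]
      refine Measurable.iInf fun a => ?_
      simp only [hφ]
      refine (hmeas _).sub ?_
      refine Finset.measurable_sum _ fun i _ => ?_
      exact (ih i i.2).const_mul _
  -- domination on the span: the Hahn–Banach induction
  have hdom : ∀ θ n (b : Fin n → ℝ), ∑ i, b i * c θ i ≤ N θ (∑ i, b i • x i) := by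
    intro θ n
    induction n with
    | zero => intro b; simp [hN0]
    | succ n ih =>
      intro b
      -- lower bounds `L d ≤ φ d'`
      have hLφ : ∀ d d' : Fin n → ℝ,
          (∑ i, d i * c θ i) - N θ ((∑ i, d i • x i) - x n) ≤ φ θ n d' := by
        intro d d'
        simp only [hφ]
        have h1 := ih (fun i => d i + d' i)
        have h2 : (∑ i : Fin n, (d i + d' i) • x i) =
            ((∑ i, d i • x i) - x n) + ((∑ i, d' i • x i) + x n) := by
          simp only [add_smul, Finset.sum_add_distrib]; abel
        have h3 : (∑ i : Fin n, (d i + d' i) * c θ i) =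
            (∑ i, d i * c θ i) + ∑ i, d' i * c θ i := by
          simp only [add_mul, Finset.sum_add_distrib]
        rw [h2, h3] at h1
        have h4 := hadd θ ((∑ i, d i • x i) - x n) ((∑ i, d' i • x i) + x n)
        linarith
      have hbdd : BddBelow (Set.range fun a : Fin n → ℚ => φ θ n (fun i => ((a i : ℚ) : ℝ))) := by
        refine ⟨(∑ i, (0 : Fin n → ℝ) i * c θ i) - N θ ((∑ i, (0 : Fin n → ℝ) i • x i) - x n), ?_⟩
        rintro _ ⟨a, rfl⟩
        exact hLφ 0 _
      -- `c θ n ≤ φ d` for every real tuple (density of rational tuples, continuity of `φ`)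
      have hcle : ∀ d : Fin n → ℝ, c θ n ≤ φ θ n d := by
        intro d
        obtain ⟨a, ha⟩ := exists_seq_ratCast_tendsto d
        have hφc : Continuous (φ θ n) := by
          simp only [hφ]
          refine ((hcont θ).comp ?_).sub ?_
          · exact (continuous_finsetSum _ fun i _ =>
              (continuous_apply i).smul continuous_const).add continuous_const
          · exact continuous_finsetSum _ fun i _ => (continuous_apply i).mul continuous_const
        have hlim : Tendsto (fun k => φ θ n (fun i => ((a k i : ℚ) : ℝ))) atTop (𝓝 (φ θ n d)) :=
          (hφc.tendsto d).comp ha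
        refine ge_of_tendsto' hlim fun k => ?_
        rw [hc_eq]
        exact ciInf_le hbdd (a k)
      -- `L d ≤ c θ n` for every real tuple
      have hcge : ∀ d : Fin n → ℝ,
          (∑ i, d i * c θ i) - N θ ((∑ i, d i • x i) - x n) ≤ c θ n := by
        intro d
        rw [hc_eq]
        exact le_ciInf fun a => hLφ d _
      -- split off the last coordinate
      rw [Fin.sum_univ_castSucc, Fin.sum_univ_castSucc]
      set b' : Fin n → ℝ := fun i => b (Fin.castSucc i) with hb'
      set t : ℝ := b (Fin.last n) with ht
      change (∑ i, b' i * c θ i) + t * c θ n ≤ N θ ((∑ i, b' i • x i) + t • x n)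
      rcases lt_trichotomy t 0 with hneg | hzero | hpos
      · -- t < 0
        set s : ℝ := -t with hs
        have hs0 : 0 < s := by linarith
        have h1 := hcge (fun i => b' i / s)
        have ht0 : t ≠ 0 := hneg.ne
        have hst : s⁻¹ * t = -1 := by rw [hs, inv_neg, neg_mul, inv_mul_cancel₀ ht0]
        have h2 : (∑ i, (b' i / s) • x i) - x n = s⁻¹ • ((∑ i, b' i • x i) + t • x n) := by
          simp only [smul_add, Finset.smul_sum, smul_smul, hst, neg_one_smul, div_eq_inv_mul,
            sub_eq_add_neg]
        have h3 : (∑ i, b' i / s * c θ i) = s⁻¹ * ∑ i, b' i * c θ i := by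
          rw [Finset.mul_sum]
          exact Finset.sum_congr rfl fun i _ => by ring
        beta_reduce at h1
        rw [h2, h3, hhom θ _ (inv_pos.2 hs0)] at h1
        have h4 : s⁻¹ * (∑ i, b' i * c θ i) - s⁻¹ * N θ ((∑ i, b' i • x i) + t • x n) ≤ c θ n := h1
        have h5 : (∑ i, b' i * c θ i) - N θ ((∑ i, b' i • x i) + t • x n) ≤ s * c θ n := by
          have := mul_le_mul_of_nonneg_left h4 hs0.le
          rwa [mul_sub, ← mul_assoc, ← mul_assoc, mul_inv_cancel₀ hs0.ne', one_mul, one_mul]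
            at this
        rw [hs] at h5
        linarith
      · -- t = 0
        rw [hzero, zero_mul, zero_smul, add_zero, add_zero]
        exact ih b'
      · -- 0 < t
        have h1 := hcle (fun i => b' i / t)
        simp only [hφ] at h1
        have h2 : (∑ i, (b' i / t) • x i) + x n = t⁻¹ • ((∑ i, b' i • x i) + t • x n) := by
          simp only [smul_add, Finset.smul_sum, smul_smul, div_eq_inv_mul,
            inv_mul_cancel₀ hpos.ne', one_smul]
        have h3 : (∑ i, b' i / t * c θ i) = t⁻¹ * ∑ i, b' i * c θ i := by
          rw [Finset.mul_sum]
          exact Finset.sum_congr rfl fun i _ => by ring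
        rw [h2, h3, hhom θ _ (inv_pos.2 hpos)] at h1
        have h5 : t * c θ n ≤ N θ ((∑ i, b' i • x i) + t • x n) - ∑ i, b' i * c θ i := by
          have := mul_le_mul_of_nonneg_left h1 hpos.le
          rwa [mul_sub, ← mul_assoc, ← mul_assoc, mul_inv_cancel₀ hpos.ne', one_mul, one_mul]
            at this
        linarith
  -- existence of a dominated continuous linear functional with the prescribed values (Hahn–Banach)
  have hexist : ∀ θ, ∃ g : V →L[ℝ] ℝ, (∀ n, g (x n) = c θ n) ∧ ∀ v, g v ≤ N θ v := by
    intro θ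
    let lc : (ℕ →₀ ℝ) →ₗ[ℝ] ℝ := Finsupp.linearCombination ℝ (c θ)
    let lx : (ℕ →₀ ℝ) →ₗ[ℝ] V := Finsupp.linearCombination ℝ x
    have hdomθ : ∀ l, lc l ≤ N θ (lx l) := by
      intro l
      obtain ⟨n, b, h1, h2⟩ := exists_fin_of_finsupp l (c θ) x
      simp only [lc, lx, Finsupp.linearCombination_apply, smul_eq_mul]
      rw [h1, h2]
      exact hdom θ n b
    let M : V → ℝ := fun v => ⨅ l : ℕ →₀ ℝ, (lc l + N θ (v - lx l))
    have hlow : ∀ v l, -N θ (-v) ≤ lc l + N θ (v - lx l) := by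
      intro v l
      have h1 := hdomθ (-l)
      rw [map_neg, map_neg] at h1
      have h2 := hadd θ (v - lx l) (-v)
      have h3 : v - lx l + -v = -lx l := by abel
      rw [h3] at h2
      linarith
    have hMbdd : ∀ v, BddBelow (Set.range fun l : ℕ →₀ ℝ => lc l + N θ (v - lx l)) := by
      intro v
      refine ⟨-N θ (-v), ?_⟩
      rintro _ ⟨l, rfl⟩
      exact hlow v l
    have hMle : ∀ v (l : ℕ →₀ ℝ), M v ≤ lc l + N θ (v - lx l) := fun v l => ciInf_le (hMbdd v) l
    have hMge : ∀ v, -N θ (-v) ≤ M v := fun v => le_ciInf fun l => hlow v l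
    have hMleN : ∀ v, M v ≤ N θ v := by
      intro v
      simpa [map_zero] using hMle v 0
    -- positive homogeneity (one-sided, then two-sided)
    have hMhom_le : ∀ (s : ℝ), 0 < s → ∀ v, M (s • v) ≤ s * M v := by
      intro s hs v
      rw [← div_le_iff₀' hs]
      refine le_ciInf fun l => ?_
      rw [div_le_iff₀' hs]
      have h1 := hMle (s • v) (s • l)
      rw [map_smul, map_smul, ← smul_sub, hhom θ s hs, smul_eq_mul] at h1
      linarith
    have hMhom : ∀ (s : ℝ), 0 < s → ∀ v, M (s • v) = s * M v := by
      intro s hs v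
      refine le_antisymm (hMhom_le s hs v) ?_
      have h1 := hMhom_le s⁻¹ (inv_pos.2 hs) (s • v)
      rw [smul_smul, inv_mul_cancel₀ hs.ne', one_smul] at h1
      have := mul_le_mul_of_nonneg_left h1 hs.le
      rwa [← mul_assoc, mul_inv_cancel₀ hs.ne', one_mul] at this
    -- subadditivity
    have hMadd : ∀ v w, M (v + w) ≤ M v + M w := by
      intro v w
      refine le_ciInf_add_ciInf fun l l' => ?_
      have h1 := hMle (v + w) (l + l')
      rw [map_add, map_add] at h1
      have h2 := hadd θ (v - lx l) (w - lx l')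
      have h3 : v - lx l + (w - lx l') = v + w - (lx l + lx l') := by abel
      rw [h3] at h2
      linarith
    -- Hahn–Banach from the zero subspace
    obtain ⟨g, -, hg⟩ := exists_extension_of_le_sublinear (⊥ : V →ₗ.[ℝ] ℝ) M hMhom hMadd (by
      intro v
      have hv : v = 0 := Subtype.ext ((Submodule.mem_bot ℝ).1 v.2)
      rw [hv]
      change (0 : ℝ) ≤ M 0
      have := hMge 0
      simpa [hN0] using this)
    have hgN : ∀ v, g v ≤ N θ v := fun v => (hg v).trans (hMleN v)
    have hgc : Continuous g :=
      continuous_of_le_of_continuous_sublinear g (N θ) (hcont θ) (hN0 θ) hgN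
    refine ⟨⟨g, hgc⟩, fun n => ?_, hgN⟩
    change g (x n) = c θ n
    refine le_antisymm ?_ ?_
    · have h1 := (hg (x n)).trans (hMle (x n) (Finsupp.single n 1))
      simp only [lc, lx, Finsupp.linearCombination_single, one_smul, sub_self, hN0, add_zero]
        at h1
      exact h1
    · have h1 := (hg (-x n)).trans (hMle (-x n) (Finsupp.single n (-1)))
      simp only [lc, lx, Finsupp.linearCombination_single, neg_smul, one_smul, sub_neg_eq_add,
        neg_add_cancel, hN0, add_zero, map_neg, smul_eq_mul, neg_mul, one_mul] at h1
      linarith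
  choose L hLx hLN using hexist
  refine ⟨L, hLN, fun v => ?_⟩
  -- the formula for `L θ v`
  let F : Θ → ℝ := fun θ => ⨅ p : (n : ℕ) × (Fin n → ℚ),
    ((∑ i, ((p.2 i : ℚ) : ℝ) * c θ i) + N θ (v - ∑ i, ((p.2 i : ℚ) : ℝ) • x i))
  have hLsum : ∀ θ n (b : Fin n → ℝ), L θ (∑ i, b i • x i) = ∑ i, b i * c θ i := by
    intro θ n b
    rw [map_sum]
    exact Finset.sum_congr rfl fun i _ => by rw [map_smul, hLx, smul_eq_mul]
  have hle_term : ∀ θ (p : (n : ℕ) × (Fin n → ℚ)),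
      L θ v ≤ (∑ i, ((p.2 i : ℚ) : ℝ) * c θ i) + N θ (v - ∑ i, ((p.2 i : ℚ) : ℝ) • x i) := by
    intro θ p
    have h1 : L θ v = L θ (∑ i, ((p.2 i : ℚ) : ℝ) • x i) +
        L θ (v - ∑ i, ((p.2 i : ℚ) : ℝ) • x i) := by
      rw [← map_add]; congr 1; abel
    rw [h1, hLsum]
    exact add_le_add le_rfl (hLN θ _)
  have hFbdd : ∀ θ, BddBelow (Set.range fun p : (n : ℕ) × (Fin n → ℚ) =>
      (∑ i, ((p.2 i : ℚ) : ℝ) * c θ i) + N θ (v - ∑ i, ((p.2 i : ℚ) : ℝ) • x i)) := by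
    intro θ
    refine ⟨L θ v, ?_⟩
    rintro _ ⟨p, rfl⟩
    exact hle_term θ p
  have hF_eq : ∀ θ, F θ = L θ v := by
    intro θ
    refine le_antisymm ?_ (le_ciInf fun p => hle_term θ p)
    have hmem : v ∈ closure (Set.range x) := by
      rw [hx.closure_range]; exact Set.mem_univ _
    obtain ⟨y, hy, hlim⟩ := mem_closure_iff_seq_limit.1 hmem
    choose m hm using fun k => Set.mem_range.1 (hy k)
    have hterm : Tendsto (fun k => c θ (m k) + N θ (v - x (m k))) atTop (𝓝 (L θ v)) := by
      have h1 : Tendsto (fun k => L θ (y k)) atTop (𝓝 (L θ v)) :=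
        ((L θ).continuous.tendsto v).comp hlim
      have h2 : Tendsto (fun k => N θ (v - y k)) atTop (𝓝 0) := by
        have h3 : Tendsto (fun k => v - y k) atTop (𝓝 0) := by
          simpa using (tendsto_const_nhds (x := v)).sub hlim
        have h4 : Tendsto (fun k => N θ (v - y k)) atTop (𝓝 (N θ 0)) :=
          ((hcont θ).tendsto 0).comp h3
        rwa [hN0] at h4
      have h4 := h1.add h2
      rw [add_zero] at h4
      refine h4.congr' (Eventually.of_forall fun k => ?_)
      rw [← hm k, hLx]
    refine ge_of_tendsto' hterm fun k => ?_
    have h5 := ciInf_le (hFbdd θ) ⟨m k + 1, fun i => if (i : ℕ) = m k then 1 else 0⟩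
    rw [sum_ite_last_smul, sum_ite_last_mul] at h5
    exact h5
  have hF_meas : Measurable F := by
    refine Measurable.iInf fun p => ?_
    have hA : Measurable fun θ => ∑ i, ((p.2 i : ℚ) : ℝ) * c θ i :=
      Finset.measurable_sum _ fun i _ => (hc_meas i).const_mul _
    have hB : Measurable fun θ => N θ (v - ∑ i, ((p.2 i : ℚ) : ℝ) • x i) := hmeas _
    exact hA.add hB
  have hfun : (fun θ => L θ v) = F := funext fun θ => (hF_eq θ).symm
  rw [hfun]
  exact hF_meas

end MeasurableHahnBanach

section Selector

open _root_.TopologicalSpace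
open scoped SchwartzMap
open Literature.Analysis.FunctionSpaces

variable {E : Type*} [NormedAddCommGroup E] [NormedSpace ℝ E]

/-- Schwartz seminorms are monotone under adding a function with disjoint support:
`p_{k,n}(z) ≤ p_{k,n}(z + z')` if `tsupport z ⊆ U`, `tsupport z' ⊆ B`, `U ∩ B = ∅`. [folklore] -/
theorem schwartzSeminorm_le_of_disjoint_tsupport {U B : Set E} (hUB : Disjoint U B) {z z' : 𝓢(E, ℝ)}
    (hz : tsupport z ⊆ U) (hz' : tsupport z' ⊆ B) (k n : ℕ) :
    SchwartzMap.seminorm ℝ k n z ≤ SchwartzMap.seminorm ℝ k n (z + z') := by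
  refine SchwartzMap.seminorm_le_bound ℝ k n z (apply_nonneg _ _) fun x => ?_
  by_cases hx : x ∈ tsupport z
  · have hxB : x ∉ tsupport z' := fun h => Set.disjoint_left.1 hUB (hz hx) (hz' h)
    have h0 : iteratedFDeriv ℝ n z' x = 0 := by
      by_contra h
      exact hxB (support_iteratedFDeriv_subset n (Function.mem_support.2 h))
    have hsum : iteratedFDeriv ℝ n (⇑(z + z')) x = iteratedFDeriv ℝ n z x := by
      have hcoe : (⇑(z + z') : E → ℝ) = (⇑z) + ⇑z' := rfl
      rw [hcoe, iteratedFDeriv_add_apply (z.smooth n).contDiffAt (z'.smooth n).contDiffAt, h0,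
        add_zero]
    rw [← hsum]
    exact SchwartzMap.le_seminorm ℝ k n (z + z') x
  · have h0 : iteratedFDeriv ℝ n z x = 0 := by
      by_contra h
      exact hx (support_iteratedFDeriv_subset n (Function.mem_support.2 h))
    rw [h0, norm_zero, mul_zero]
    exact apply_nonneg _ _

/-- Test functions supported in a fixed set are stable under addition. [folklore] -/
theorem tsupport_add_subset_of_subset {S : Set E} {f g : 𝓢(E, ℝ)} (hf : tsupport f ⊆ S)
    (hg : tsupport g ⊆ S) : tsupport (⇑(f + g)) ⊆ S := by
  change tsupport (fun y => f y + g y) ⊆ S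
  exact (tsupport_add (⇑f) (⇑g)).trans (Set.union_subset hf hg)

/-- Test functions supported in a fixed set are stable under negation. [folklore] -/
theorem tsupport_neg_subset_of_subset {S : Set E} {f : 𝓢(E, ℝ)} (hf : tsupport f ⊆ S) :
    tsupport (⇑(-f)) ⊆ S := by
  change tsupport (fun y => -f y) ⊆ S
  rw [tsupport_fun_neg]
  exact hf

/-- Test functions supported in a fixed set are stable under scalar multiplication. [folklore] -/
theorem tsupport_smul_subset_of_subset {S : Set E} {f : 𝓢(E, ℝ)} (hf : tsupport f ⊆ S) (c : ℝ) :
    tsupport (⇑(c • f)) ⊆ S := by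
  change tsupport (fun y => c • f y) ⊆ S
  exact (tsupport_smul_subset_right (fun _ : E => c) (⇑f)).trans hf

/-- The zero test function is supported in every set. [folklore] -/
theorem tsupport_zero_subset (S : Set E) : tsupport (⇑(0 : 𝓢(E, ℝ))) ⊆ S := by
  have : tsupport (⇑(0 : 𝓢(E, ℝ))) = ∅ := tsupport_eq_empty_iff.2 rfl
  rw [this]
  exact Set.empty_subset S

/-- A dense sequence inside a set of test functions containing `0` (every subset of `𝓢(E, ℝ)` is
separable, `E` finite-dimensional). [folklore] -/
theorem exists_denseSeq_subset [FiniteDimensional ℝ E] (Z : Set 𝓢(E, ℝ)) (h0 : (0 : 𝓢(E, ℝ)) ∈ Z) :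
    ∃ z : ℕ → 𝓢(E, ℝ), (∀ i, z i ∈ Z) ∧ Z ⊆ closure (Set.range z) := by
  obtain ⟨D, hDZ, hDc, hZD⟩ :=
    Literature.Analysis.FunctionSpaces.SchwartzMap.exists_countable_dense_subset_schwartzMap E ℝ Z
  obtain ⟨z, hz⟩ := (hDc.insert 0).exists_eq_range (Set.insert_nonempty 0 D)
  refine ⟨z, fun i => ?_, ?_⟩
  · have : z i ∈ insert (0 : 𝓢(E, ℝ)) D := by rw [hz]; exact Set.mem_range_self i
    rcases (Set.mem_insert_iff).1 this with h | h
    · rw [h]; exact h0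
    · exact hDZ h
  · rw [← hz]
    exact hZD.trans (closure_mono (Set.subset_insert _ _))

/-- **Measurable kill-inside extension selector.** For disjoint `U, B ⊆ E` (`E` finite-dimensional)
there is `P : FieldConfig E → FieldConfig E` with `P ξ f = ξ f` whenever `tsupport f ⊆ U`, `P ξ f = 0`
whenever `tsupport f ⊆ B`, and `ξ ↦ P ξ v` measurable for `extEvents U` for every `v`. (Hahn–Banach
extension of `z + z' ↦ ξ z`, dominated by `K(ξ) · P_{K(ξ)}` thanks to the disjointness of supports,
chosen measurably in `ξ` by `exists_clm_le_sublinear_measurable`.) [folklore] -/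
theorem exists_killInside_selector [FiniteDimensional ℝ E] {U B : Set E} (hUB : Disjoint U B) :
    ∃ P : FieldConfig E → FieldConfig E,
      (∀ (ξ : FieldConfig E) (f : 𝓢(E, ℝ)), tsupport f ⊆ U → P ξ f = ξ f) ∧
      (∀ (ξ : FieldConfig E) (f : 𝓢(E, ℝ)), tsupport f ⊆ B → P ξ f = 0) ∧
      ∀ v : 𝓢(E, ℝ), Measurable[extEvents U] fun ξ => P ξ v := by
  classical
  letI mU : MeasurableSpace (FieldConfig E) := extEvents U
  haveI : SeparableSpace 𝓢(E, ℝ) := separableSpace_schwartzMap_holds E ℝ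
  -- the Schwartz seminorms and the dominating sums `Pf m = ∑_{i ≤ (m,m)} p i`
  set p : ℕ × ℕ → Seminorm ℝ 𝓢(E, ℝ) := schwartzSeminormFamily ℝ E ℝ with hp
  let Pf : ℕ → 𝓢(E, ℝ) → ℝ := fun m v => ∑ i ∈ Finset.Iic (m, m), p i v
  have Pf_nonneg : ∀ m v, 0 ≤ Pf m v := fun m v => Finset.sum_nonneg fun i _ => apply_nonneg _ _
  have Pf_add : ∀ m v w, Pf m (v + w) ≤ Pf m v + Pf m w := by
    intro m v w
    simp only [Pf, ← Finset.sum_add_distrib]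
    exact Finset.sum_le_sum fun i _ => map_add_le_add _ _ _
  have Pf_smul : ∀ m (c : ℝ) v, Pf m (c • v) = |c| * Pf m v := by
    intro m c v
    simp only [Pf, map_smul_eq_mul, Real.norm_eq_abs, Finset.mul_sum]
  have Pf_neg : ∀ m v, Pf m (-v) = Pf m v := by
    intro m v
    simp only [Pf, map_neg_eq_map]
  have Pf_zero : ∀ m, Pf m 0 = 0 := fun m => by simp only [Pf, map_zero, Finset.sum_const_zero]
  have Pf_cont : ∀ m, Continuous (Pf m) := fun m =>
    continuous_finsetSum _ fun i _ => (schwartz_withSeminorms ℝ E ℝ).continuous_seminorm i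
  have Pf_mono : ∀ m (z z' : 𝓢(E, ℝ)), tsupport z ⊆ U → tsupport z' ⊆ B →
      Pf m z ≤ Pf m (z + z') := by
    intro m z z' hz hz'
    exact Finset.sum_le_sum fun i _ => schwartzSeminorm_le_of_disjoint_tsupport hUB hz hz' i.1 i.2
  -- every configuration is dominated by some `m • Pf m`
  have hbound : ∀ ξ : FieldConfig E, ∃ m : ℕ, ∀ f, |ξ f| ≤ m * Pf m f := by
    intro ξ
    let q : Seminorm ℝ 𝓢(E, ℝ) := (normSeminorm ℝ ℝ).comp (ξ : 𝓢(E, ℝ) →L[ℝ] ℝ).toLinearMap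
    have hq : Continuous q := continuous_norm.comp ξ.continuous
    obtain ⟨s, C, -, hC⟩ := Seminorm.bound_of_continuous (schwartz_withSeminorms ℝ E ℝ) q hq
    refine ⟨max ⌈(C : ℝ)⌉₊ (s.sup fun i => max i.1 i.2), fun f => ?_⟩
    set m : ℕ := max ⌈(C : ℝ)⌉₊ (s.sup fun i => max i.1 i.2) with hm
    have h0 : q f ≤ (C • s.sup p) f := Seminorm.le_def.1 hC f
    have h1 : |ξ f| ≤ C * (s.sup p) f := by
      have h0' : q f ≤ (C : ℝ) * (s.sup p) f := by simpa [NNReal.smul_def, smul_eq_mul] using h0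
      have hqf : q f = |ξ f| := by
        simp only [q, Seminorm.comp_apply, coe_normSeminorm, Real.norm_eq_abs]
        rfl
      rw [← hqf]
      exact h0'
    have h2 : (s.sup p) f ≤ Pf m f := by
      refine Seminorm.finset_sup_apply_le (Pf_nonneg m f) fun i hi => ?_
      have him : i ∈ Finset.Iic (m, m) := by
        rw [Finset.mem_Iic]
        have : max i.1 i.2 ≤ m :=
          (Finset.le_sup (f := fun i : ℕ × ℕ => max i.1 i.2) hi).trans (le_max_right _ _)
        exact ⟨(le_max_left _ _).trans this, (le_max_right _ _).trans this⟩
      exact Finset.single_le_sum (f := fun i => p i f) (fun j _ => apply_nonneg _ _) him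
    have hCm : (C : ℝ) ≤ m := (Nat.le_ceil _).trans (by exact_mod_cast le_max_left _ _)
    calc |ξ f| ≤ C * (s.sup p) f := h1
      _ ≤ m * Pf m f := mul_le_mul hCm h2 (apply_nonneg _ _) (Nat.cast_nonneg _)
  -- dense sequences: in `𝓢`, in the `U`-supported and in the `B`-supported test functions
  obtain ⟨x, hx⟩ := TopologicalSpace.exists_dense_seq 𝓢(E, ℝ)
  obtain ⟨zU, hzU, hzUd⟩ := exists_denseSeq_subset {f : 𝓢(E, ℝ) | tsupport f ⊆ U}
    (tsupport_zero_subset U)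
  obtain ⟨zB, hzB, hzBd⟩ := exists_denseSeq_subset {f : 𝓢(E, ℝ) | tsupport f ⊆ B}
    (tsupport_zero_subset B)
  simp only [Set.mem_setOf_eq] at hzU hzB
  -- the minimal admissible order `K ξ`, read off the dense sequence `zU`
  have hbound' : ∀ ξ : FieldConfig E, ∃ m : ℕ, ∀ i, |ξ (zU i)| ≤ m * Pf m (zU i) :=
    fun ξ => (hbound ξ).imp fun m hm i => hm (zU i)
  let K : FieldConfig E → ℕ := fun ξ => Nat.find (hbound' ξ)
  have hK_spec : ∀ ξ i, |ξ (zU i)| ≤ K ξ * Pf (K ξ) (zU i) := fun ξ => Nat.find_spec (hbound' ξ)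
  have hK_meas : Measurable K := by
    refine measurable_find _ fun m => ?_
    have : {ξ : FieldConfig E | ∀ i, |ξ (zU i)| ≤ m * Pf m (zU i)} =
        ⋂ i, {ξ : FieldConfig E | |ξ (zU i)| ≤ m * Pf m (zU i)} := by
      ext ξ; simp
    rw [this]
    exact MeasurableSet.iInter fun i =>
      measurableSet_le (measurable_eval_of_tsupport_subset (hzU i)).abs measurable_const
  have hK_dom : ∀ (ξ : FieldConfig E) (z : 𝓢(E, ℝ)), tsupport z ⊆ U →
      |ξ z| ≤ K ξ * Pf (K ξ) z := by
    intro ξ z hz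
    have hcl : IsClosed {w : 𝓢(E, ℝ) | |ξ w| ≤ K ξ * Pf (K ξ) w} :=
      isClosed_le (continuous_abs.comp ξ.continuous) (continuous_const.mul (Pf_cont _))
    have hsub : Set.range zU ⊆ {w : 𝓢(E, ℝ) | |ξ w| ≤ K ξ * Pf (K ξ) w} := by
      rintro _ ⟨i, rfl⟩; exact hK_spec ξ i
    exact hcl.closure_subset_iff.2 hsub (hzUd hz)
  -- the dominating function `q ξ = K ξ • Pf (K ξ)`
  let q : FieldConfig E → 𝓢(E, ℝ) → ℝ := fun ξ v => (K ξ : ℝ) * Pf (K ξ) v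
  have q_nonneg : ∀ ξ v, 0 ≤ q ξ v := fun ξ v => mul_nonneg (Nat.cast_nonneg _) (Pf_nonneg _ _)
  have q_add : ∀ ξ v w, q ξ (v + w) ≤ q ξ v + q ξ w := by
    intro ξ v w
    simp only [q, ← mul_add]
    exact mul_le_mul_of_nonneg_left (Pf_add _ _ _) (Nat.cast_nonneg _)
  have q_smul : ∀ ξ (c : ℝ) v, q ξ (c • v) = |c| * q ξ v := by
    intro ξ c v
    simp only [q, Pf_smul]
    ring
  have q_neg : ∀ ξ v, q ξ (-v) = q ξ v := fun ξ v => by simp only [q, Pf_neg]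
  have q_zero : ∀ ξ, q ξ 0 = 0 := fun ξ => by simp only [q, Pf_zero, mul_zero]
  have q_cont : ∀ ξ, Continuous (q ξ) := fun ξ => continuous_const.mul (Pf_cont _)
  have q_meas : ∀ v, Measurable fun ξ => q ξ v := fun v =>
    (measurable_from_top (f := fun m : ℕ => (m : ℝ) * Pf m v)).comp hK_meas
  have q_sub_le : ∀ ξ a b, q ξ a ≤ q ξ b + q ξ (a - b) := by
    intro ξ a b
    have := q_add ξ b (a - b)
    rwa [add_sub_cancel] at this
  have hdomU : ∀ (ξ : FieldConfig E) (z z' : 𝓢(E, ℝ)), tsupport z ⊆ U → tsupport z' ⊆ B →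
      |ξ z| ≤ q ξ (z + z') := fun ξ z z' hz hz' =>
    (hK_dom ξ z hz).trans (mul_le_mul_of_nonneg_left (Pf_mono _ z z' hz hz') (Nat.cast_nonneg _))
  -- the sublinear functionals `Nf ξ`
  let Nf : FieldConfig E → 𝓢(E, ℝ) → ℝ := fun ξ v =>
    ⨅ ij : ℕ × ℕ, (ξ (zU ij.1) + q ξ (v - zU ij.1 - zB ij.2))
  have hlow : ∀ ξ v (ij : ℕ × ℕ), -q ξ v ≤ ξ (zU ij.1) + q ξ (v - zU ij.1 - zB ij.2) := by
    intro ξ v ij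
    have h1 := hdomU ξ (zU ij.1) (zB ij.2) (hzU _) (hzB _)
    have h2 : q ξ (zU ij.1 + zB ij.2) ≤ q ξ v + q ξ (v - zU ij.1 - zB ij.2) := by
      have h3 := q_add ξ v (-(v - zU ij.1 - zB ij.2))
      rw [q_neg] at h3
      have h4 : v + -(v - zU ij.1 - zB ij.2) = zU ij.1 + zB ij.2 := by abel
      rwa [h4] at h3
    have h5 := neg_abs_le (ξ (zU ij.1))
    linarith
  have hbdd : ∀ ξ v, BddBelow (Set.range fun ij : ℕ × ℕ =>
      ξ (zU ij.1) + q ξ (v - zU ij.1 - zB ij.2)) := by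
    intro ξ v
    refine ⟨-q ξ v, ?_⟩
    rintro _ ⟨ij, rfl⟩
    exact hlow ξ v ij
  have hNle : ∀ ξ v (ij : ℕ × ℕ), Nf ξ v ≤ ξ (zU ij.1) + q ξ (v - zU ij.1 - zB ij.2) :=
    fun ξ v ij => ciInf_le (hbdd ξ v) ij
  have hNge : ∀ ξ v, -q ξ v ≤ Nf ξ v := fun ξ v => le_ciInf fun ij => hlow ξ v ij
  -- `Nf ξ v ≤ ξ z + q ξ (v - z - z')` for ALL admissible `z, z'` (density)
  have hN_all : ∀ (ξ : FieldConfig E) (v z z' : 𝓢(E, ℝ)), tsupport z ⊆ U → tsupport z' ⊆ B →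
      Nf ξ v ≤ ξ z + q ξ (v - z - z') := by
    intro ξ v z z' hz hz'
    obtain ⟨y, hy, hylim⟩ := mem_closure_iff_seq_limit.1 (hzUd hz)
    choose a ha using fun k => Set.mem_range.1 (hy k)
    obtain ⟨y', hy', hy'lim⟩ := mem_closure_iff_seq_limit.1 (hzBd hz')
    choose b hb using fun k => Set.mem_range.1 (hy' k)
    have hlim : Tendsto (fun k => ξ (zU (a k)) + q ξ (v - zU (a k) - zB (b k))) atTop
        (𝓝 (ξ z + q ξ (v - z - z'))) := by
      have h1 : Tendsto (fun k => zU (a k)) atTop (𝓝 z) := by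
        have : (fun k => zU (a k)) = y := funext ha
        rwa [this]
      have h2 : Tendsto (fun k => zB (b k)) atTop (𝓝 z') := by
        have : (fun k => zB (b k)) = y' := funext hb
        rwa [this]
      have h3 : Tendsto (fun k => ξ (zU (a k))) atTop (𝓝 (ξ z)) := (ξ.continuous.tendsto z).comp h1
      have h4 : Tendsto (fun k => v - zU (a k) - zB (b k)) atTop (𝓝 (v - z - z')) :=
        (tendsto_const_nhds.sub h1).sub h2
      exact h3.add (((q_cont ξ).tendsto _).comp h4)
    exact ge_of_tendsto' hlim fun k => hNle ξ v (a k, b k)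
  -- sublinearity of `Nf ξ`
  have Nf_add : ∀ ξ v w, Nf ξ (v + w) ≤ Nf ξ v + Nf ξ w := by
    intro ξ v w
    refine le_ciInf_add_ciInf fun ij ij' => ?_
    have h1 := hN_all ξ (v + w) (zU ij.1 + zU ij'.1) (zB ij.2 + zB ij'.2)
      (tsupport_add_subset_of_subset (hzU _) (hzU _)) (tsupport_add_subset_of_subset (hzB _) (hzB _))
    rw [map_add] at h1
    have h2 := q_add ξ (v - zU ij.1 - zB ij.2) (w - zU ij'.1 - zB ij'.2)
    have h3 : v - zU ij.1 - zB ij.2 + (w - zU ij'.1 - zB ij'.2) =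
        v + w - (zU ij.1 + zU ij'.1) - (zB ij.2 + zB ij'.2) := by abel
    rw [h3] at h2
    linarith
  have Nf_hom_le : ∀ ξ (c : ℝ), 0 < c → ∀ v, Nf ξ (c • v) ≤ c * Nf ξ v := by
    intro ξ c hc v
    rw [← div_le_iff₀' hc]
    refine le_ciInf fun ij => ?_
    rw [div_le_iff₀' hc]
    have h1 := hN_all ξ (c • v) (c • zU ij.1) (c • zB ij.2)
      (tsupport_smul_subset_of_subset (hzU _) c) (tsupport_smul_subset_of_subset (hzB _) c)
    rw [map_smul, smul_eq_mul, ← smul_sub, ← smul_sub, q_smul, abs_of_pos hc] at h1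
    linarith
  have Nf_hom : ∀ ξ (c : ℝ), 0 < c → ∀ v, Nf ξ (c • v) = c * Nf ξ v := by
    intro ξ c hc v
    refine le_antisymm (Nf_hom_le ξ c hc v) ?_
    have h1 := Nf_hom_le ξ c⁻¹ (inv_pos.2 hc) (c • v)
    rw [smul_smul, inv_mul_cancel₀ hc.ne', one_smul] at h1
    have := mul_le_mul_of_nonneg_left h1 hc.le
    rwa [← mul_assoc, mul_inv_cancel₀ hc.ne', one_mul] at this
  have Nf_lip : ∀ ξ v w, Nf ξ v ≤ Nf ξ w + q ξ (v - w) := by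
    intro ξ v w
    rw [← sub_le_iff_le_add]
    refine le_ciInf fun ij => ?_
    rw [sub_le_iff_le_add]
    have h1 := hNle ξ v ij
    have h2 := q_add ξ (w - zU ij.1 - zB ij.2) (v - w)
    have h3 : w - zU ij.1 - zB ij.2 + (v - w) = v - zU ij.1 - zB ij.2 := by abel
    rw [h3] at h2
    linarith
  have Nf_cont : ∀ ξ, Continuous (Nf ξ) := by
    intro ξ
    refine continuous_iff_continuousAt.2 fun w => ?_
    have hup : Tendsto (fun v => Nf ξ w + q ξ (v - w)) (𝓝 w) (𝓝 (Nf ξ w)) := by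
      have h1 : Tendsto (fun v : 𝓢(E, ℝ) => v - w) (𝓝 w) (𝓝 0) := by
        simpa using (tendsto_id (x := 𝓝 w)).sub (tendsto_const_nhds (x := w))
      have h2 : Tendsto (fun v => q ξ (v - w)) (𝓝 w) (𝓝 (q ξ 0)) :=
        ((q_cont ξ).tendsto 0).comp h1
      rw [q_zero] at h2
      simpa using (tendsto_const_nhds (x := Nf ξ w)).add h2
    have hlow' : Tendsto (fun v => Nf ξ w - q ξ (w - v)) (𝓝 w) (𝓝 (Nf ξ w)) := by
      have h1 : Tendsto (fun v : 𝓢(E, ℝ) => w - v) (𝓝 w) (𝓝 0) := by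
        simpa using (tendsto_const_nhds (x := w)).sub (tendsto_id (x := 𝓝 w))
      have h2 : Tendsto (fun v => q ξ (w - v)) (𝓝 w) (𝓝 (q ξ 0)) :=
        ((q_cont ξ).tendsto 0).comp h1
      rw [q_zero] at h2
      simpa using (tendsto_const_nhds (x := Nf ξ w)).sub h2
    refine tendsto_of_tendsto_of_tendsto_of_le_of_le hlow' hup (fun v => ?_) (fun v => Nf_lip ξ v w)
    have := Nf_lip ξ w v
    linarith
  have Nf_meas : ∀ v, Measurable fun ξ => Nf ξ v := by
    intro v
    refine Measurable.iInf fun ij => ?_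
    have hA : Measurable fun ξ : FieldConfig E => ξ (zU ij.1) :=
      measurable_eval_of_tsupport_subset (hzU ij.1)
    have hB : Measurable fun ξ : FieldConfig E => q ξ (v - zU ij.1 - zB ij.2) := q_meas _
    exact hA.add hB
  -- the measurable Hahn–Banach selector
  obtain ⟨L, hLN, hLmeas⟩ :=
    exists_clm_le_sublinear_measurable x hx Nf Nf_add Nf_hom Nf_cont Nf_meas
  refine ⟨fun ξ => ContinuousLinearMap.toPointwiseConvergenceCLM _ _ _ _ (L ξ), ?_, ?_, ?_⟩
  · intro ξ f hf
    change L ξ f = ξ f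
    refine le_antisymm ?_ ?_
    · have h1 := (hLN ξ f).trans (hN_all ξ f f 0 hf (tsupport_zero_subset B))
      rwa [sub_self, sub_zero, q_zero, add_zero] at h1
    · have h1 := (hLN ξ (-f)).trans (hN_all ξ (-f) (-f) 0 (tsupport_neg_subset_of_subset hf)
        (tsupport_zero_subset B))
      rw [sub_self, sub_zero, q_zero, add_zero, map_neg, map_neg] at h1
      linarith
  · intro ξ f hf
    change L ξ f = 0
    refine le_antisymm ?_ ?_
    · have h1 := (hLN ξ f).trans (hN_all ξ f 0 f (tsupport_zero_subset U) hf)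
      rwa [sub_zero, sub_self, q_zero, add_zero, map_zero] at h1
    · have h1 := (hLN ξ (-f)).trans (hN_all ξ (-f) 0 (-f) (tsupport_zero_subset U)
        (tsupport_neg_subset_of_subset hf))
      rw [sub_zero, sub_self, q_zero, add_zero, map_zero, map_neg] at h1
      linarith
  · intro v
    exact hLmeas v

end Selector

end Literature.MathematicalPhysics.QuantumLattice

end
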